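import Summits.QuantumAdvantage.AdviceFreeQNC0.BondPathSum
import Summits.QuantumAdvantage.AdviceFreeQNC0.RingLinFormsGlue
import HarnessLib

/-!
# Cell qa-qnc0, `p = 3` — **`twistBoundX3 : TwistBoundX3`** (planner qa-qnc0-p1 g20, ask P-20a(1); ROUND-19 §2;
`exp20/Sketch20x.lean` §1, statement VERBATIM in `BondTwist.lean`)

For every FIXED bell set `B ⊆ Fin N` and every `γ ∈ (ZMod 3)^N`, the correlation of the win indicator of the constant-bell
strategy `tGuess ⊕ 1_B` on the odd class with the x-LINEAR phase `e₃(Σ_{i : x_i} γ_i)` is `≤ 9·(√3/2)^{#supp γ}·2^N`.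

Proof: transport to walk coordinates (`sum_odd_eq_sum_u`, `rel_iff_ringWinU`), `[WIN] = (1 − sgnU)/2`
(`win_indicator_eq`), the sign as a 3-term path product (`ConstBells.sgnU_eq_sum`), the x-phase as a BOND product
(`bondProd_eq_char`), the bond-twisted path-sum identity (`bond_pathSum_eq`) and the norm recursion with the factor `3`
instead of `4` at every twisted site (`btvNorm_succ_le_three`, i.e. `(√3/2)²` per site after normalisation).
This is the ERROR TERM of rung R-lin3: with `ringLinFormsSharp3_of` (`RingLinFormsGlue.lean`) the rung
`RingLinFormsSharp3` is now conditional on the main term `RingJuntaBellsSharp3` (`⇐ RingWindowBellsSharp3`) only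
(`ringLinFormsSharp3_of_junta`, `ringLinFormsSharp3_of_window`, `ringLinFormsLt3_of_window`).

WHAT THIS IS NOT: the main term `RingWindowBellsSharp3` is open; crux 22907 untouched; separation NOT moved.
-/

noncomputable section

namespace Summit.QuantumAdvantage.AdviceFreeQNC0

open Finset Literature.Computability.MetaComplexity Literature.Computability.QuantumComplexity
open Literature.Computability.QuantumComplexity.RingHLF

namespace BondTwist3

open TransferWalk ConstBells TwistedTransfer

variable {n : ℕ}

/-! ## The x-phase is a bond product -/

/-- `ext false u j` is the chart's "previous step". -/
theorem ext_false_eq (u : Fin n → Bool) (j : ℕ) :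
    ext false u j = (if j = 0 then false else uExt u (j - 1)) := by
  cases j with
  | zero => rfl
  | succ j => simp only [ext, uExt, Nat.succ_ne_zero, if_false, Nat.add_sub_cancel]

/-- `ext false u (j+1) = uExt u j`. -/
theorem ext_false_succ (u : Fin n → Bool) (j : ℕ) : ext false u (j + 1) = uExt u j := rfl

/-- The bond phase at site `j` is the x-phase of the chart bit `x_j`. -/
theorem bondPh_eq_ite (γ : Fin (n + 1) → ZMod 3) (u : Fin n → Bool) (j : Fin (n + 1)) :
    bondPh (phase γ) j.val (ext false u j.val) (ext false u (j.val + 1)) =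
      (if xOfU u j then phase γ j.val else 1) := by
  rw [ext_false_succ, ext_false_eq]
  unfold bondPh xOfU
  generalize uExt u j.val = b
  generalize (if j.val = 0 then false else uExt u (j.val - 1)) = c
  cases b <;> cases c <;> rfl

/-- **The x-linear phase is the bond product** along the walk. -/
theorem bondProd_eq_char (γ : Fin (n + 1) → ZMod 3) (u : Fin n → Bool) :
    (∏ g ∈ range (n + 1), bondPh (phase γ) g (ext false u g) (ext false u (g + 1))) =
      (ZMod.stdAddChar (∑ i : Fin (n + 1), if xOfU u i then γ i else 0) : ℂ) := by
  rw [char_eq_prod γ (xOfU u), ← Fin.prod_univ_eq_prod_range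
    (fun g => bondPh (phase γ) g (ext false u g) (ext false u (g + 1))) (n + 1)]
  exact Finset.prod_congr rfl fun j _ => bondPh_eq_ite γ u j

/-! ## The twisted sign sum as bond-twisted path sums -/

/-- `st = posZ`. -/
theorem st_eq_posZ (u : Fin n → Bool) (j : ℕ) : st u j = posZ u j := rfl

/-- **The twisted sign sum**: `Σ_u e₃(⟨γ, x(u)⟩)·sgnU_B(u) = Σ_τ BTV_τ(n, 0, 0, false)`. -/
theorem sum_char_sgnU_eq (γ : Fin (n + 1) → ZMod 3) (c : ℕ) (B : Finset (Fin (n + 1))) :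
    ∑ u : Fin n → Bool, (ZMod.stdAddChar (∑ i : Fin (n + 1), if xOfU u i then γ i else 0) : ℂ) * (sgnU c B u : ℂ) =
      ∑ τ : ZMod 3, BTV (phase γ) (fT (bellsN B) n (((c + 2 * n : ℕ) : ZMod 3)) τ) n 0 0 false := by
  have h : ∀ u : Fin n → Bool,
      (ZMod.stdAddChar (∑ i : Fin (n + 1), if xOfU u i then γ i else 0) : ℂ) * (sgnU c B u : ℂ) =
        ∑ τ : ZMod 3, bondSummand (phase γ) (fT (bellsN B) n (((c + 2 * n : ℕ) : ZMod 3)) τ) n 0 0 false u := by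
    intro u
    rw [sgnU_eq_sum, Complex.ofReal_sum, Finset.mul_sum]
    refine Finset.sum_congr rfl fun τ _ => ?_
    unfold bondSummand
    have e1 : (∏ g ∈ range (n + 1), (fT (bellsN B) n (((c + 2 * n : ℕ) : ZMod 3)) τ (0 + g) (0 + posZ u g) : ℂ)) =
        ((∏ j ∈ range (n + 1), fT (bellsN B) n (((c + 2 * n : ℕ) : ZMod 3)) τ j (st u j) : ℝ) : ℂ) := by
      rw [Complex.ofReal_prod]
      exact Finset.prod_congr rfl fun g _ => by rw [zero_add, zero_add, st_eq_posZ]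
    have e2 : (∏ g ∈ range (n + 1), bondPh (phase γ) (0 + g) (ext false u g) (ext false u (g + 1))) =
        (ZMod.stdAddChar (∑ i : Fin (n + 1), if xOfU u i then γ i else 0) : ℂ) := by
      rw [← bondProd_eq_char]
      exact Finset.prod_congr rfl fun g _ => by rw [zero_add]
    rw [e1, e2, mul_comm]
  simp_rw [h]
  rw [Finset.sum_comm]
  exact Finset.sum_congr rfl fun τ _ => bond_pathSum_eq _ _ n 0 0 false

/-! ## Norm bookkeeping -/

/-- Site phases are unimodular or `1`. -/
theorem norm_phase_le_one (γ : Fin (n + 1) → ZMod 3) (j : ℕ) : ‖phase γ j‖ ≤ 1 := by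
  unfold phase
  split_ifs with h
  · have h3 := stdAddChar_cube (γ ⟨j, h⟩)
    have hn : ‖(ZMod.stdAddChar (γ ⟨j, h⟩) : ℂ)‖ ^ 3 = 1 := by rw [← norm_pow, h3, norm_one]
    exact ((pow_eq_one_iff_of_nonneg (norm_nonneg _) (by norm_num)).1 hn).le
  · simp

/-- **Iterated norm recursion**: `btvNorm k a ≤ (Π_{g<k} 4·siteRho(a+g)²) · btvNorm 0 (a+k)`. -/
theorem btvNorm_le_prod (γ : Fin (n + 1) → ZMod 3) (f : ℕ → ZMod 3 → ℝ) (hf : ∀ j s, f j s ^ 2 ≤ 1) :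
    ∀ k a : ℕ, btvNorm (phase γ) f k a ≤
      (∏ g ∈ range k, 4 * siteRho γ (Real.sqrt 3 / 2) (a + g) ^ 2) * btvNorm (phase γ) f 0 (a + k)
  | 0, a => by simp
  | k + 1, a => by
    have hstep : btvNorm (phase γ) f (k + 1) a ≤
        4 * siteRho γ (Real.sqrt 3 / 2) a ^ 2 * btvNorm (phase γ) f k (a + 1) := by
      unfold siteRho
      by_cases ha : a < n + 1
      · rw [dif_pos ha]
        by_cases h0 : γ ⟨a, ha⟩ = 0
        · rw [if_pos h0, one_pow, mul_one]
          exact btvNorm_succ_le_four _ f hf k a (norm_phase_le_one γ a)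
        · rw [if_neg h0, div_pow, Real.sq_sqrt (by norm_num : (0 : ℝ) ≤ 3)]
          have hph : phase γ a = (ZMod.stdAddChar (γ ⟨a, ha⟩) : ℂ) := by unfold phase; rw [dif_pos ha]
          have h3 : phase γ a ^ 3 = 1 := by rw [hph]; exact stdAddChar_cube _
          have h1 : phase γ a ≠ 1 := by rw [hph]; exact stdAddChar_ne_one h0
          have := btvNorm_succ_le_three _ f hf k a h3 h1
          linarith
      · rw [dif_neg ha, one_pow, mul_one]
        exact btvNorm_succ_le_four _ f hf k a (norm_phase_le_one γ a)
    have ih := btvNorm_le_prod γ f hf k (a + 1)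
    have hprod : (∏ g ∈ range (k + 1), 4 * siteRho γ (Real.sqrt 3 / 2) (a + g) ^ 2) =
        4 * siteRho γ (Real.sqrt 3 / 2) a ^ 2 * ∏ g ∈ range k, 4 * siteRho γ (Real.sqrt 3 / 2) (a + 1 + g) ^ 2 := by
      rw [Finset.prod_range_succ' (fun g => 4 * siteRho γ (Real.sqrt 3 / 2) (a + g) ^ 2), add_zero, mul_comm]
      congr 1
      exact Finset.prod_congr rfl fun g _ => by rw [show a + (g + 1) = a + 1 + g by omega]
    rw [hprod, show a + (k + 1) = a + 1 + k by omega]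
    have hc : 0 ≤ 4 * siteRho γ (Real.sqrt 3 / 2) a ^ 2 := by positivity
    calc btvNorm (phase γ) f (k + 1) a ≤ 4 * siteRho γ (Real.sqrt 3 / 2) a ^ 2 * btvNorm (phase γ) f k (a + 1) := hstep
      _ ≤ 4 * siteRho γ (Real.sqrt 3 / 2) a ^ 2 *
          ((∏ g ∈ range k, 4 * siteRho γ (Real.sqrt 3 / 2) (a + 1 + g) ^ 2) * btvNorm (phase γ) f 0 (a + 1 + k)) :=
          mul_le_mul_of_nonneg_left ih hc
      _ = 4 * siteRho γ (Real.sqrt 3 / 2) a ^ 2 * (∏ g ∈ range k, 4 * siteRho γ (Real.sqrt 3 / 2) (a + 1 + g) ^ 2) *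
          btvNorm (phase γ) f 0 (a + 1 + k) := by ring

/-- The product of the first `n` site factors: `Π_{g<n} 4·siteRho(g)² ≤ (4/3)·4^n·(3/4)^{#supp γ}`. -/
theorem prod_site_le (γ : Fin (n + 1) → ZMod 3) :
    (∏ g ∈ range n, 4 * siteRho γ (Real.sqrt 3 / 2) g ^ 2) ≤
      4 / 3 * (4 : ℝ) ^ n * (3 / 4 : ℝ) ^ (univ.filter fun i : Fin (n + 1) => γ i ≠ 0).card := by
  have hρ : (Real.sqrt 3 / 2 : ℝ) ^ 2 = 3 / 4 := by rw [div_pow, Real.sq_sqrt (by norm_num : (0 : ℝ) ≤ 3)]; norm_num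
  have hfull := prod_siteRho_sq γ (Real.sqrt 3 / 2)
  simp only [zero_add] at hfull
  rw [Finset.prod_range_succ, hρ] at hfull
  have hsplit : (∏ g ∈ range n, 4 * siteRho γ (Real.sqrt 3 / 2) g ^ 2) =
      (4 : ℝ) ^ n * ∏ g ∈ range n, siteRho γ (Real.sqrt 3 / 2) g ^ 2 := by
    rw [Finset.prod_mul_distrib, Finset.prod_const, Finset.card_range]
  rw [hsplit]
  have hlast : 3 / 4 ≤ siteRho γ (Real.sqrt 3 / 2) n ^ 2 := by
    unfold siteRho
    split_ifs
    · norm_num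
    · rw [hρ]
    · norm_num
  have hP : 0 ≤ ∏ g ∈ range n, siteRho γ (Real.sqrt 3 / 2) g ^ 2 := Finset.prod_nonneg fun g _ => by positivity
  have h4 : (0 : ℝ) ≤ (4 : ℝ) ^ n := by positivity
  -- `(3/4)·P ≤ P·siteRho(n)² = (3/4)^w`
  have key : 3 / 4 * ∏ g ∈ range n, siteRho γ (Real.sqrt 3 / 2) g ^ 2 ≤
      (3 / 4 : ℝ) ^ (univ.filter fun i : Fin (n + 1) => γ i ≠ 0).card := by
    rw [← hfull]
    nlinarith [mul_le_mul_of_nonneg_left hlast hP]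
  nlinarith

/-- **The twisted sign sum is small**: `‖Σ_u e₃(⟨γ, x(u)⟩)·sgnU_B(u)‖ ≤ 9·(√3/2)^{#supp γ}·2ⁿ`. -/
theorem norm_sum_char_sgnU_le (γ : Fin (n + 1) → ZMod 3) (c : ℕ) (B : Finset (Fin (n + 1))) :
    ‖∑ u : Fin n → Bool, (ZMod.stdAddChar (∑ i : Fin (n + 1), if xOfU u i then γ i else 0) : ℂ) * (sgnU c B u : ℂ)‖ ≤
      9 * (Real.sqrt 3 / 2) ^ (univ.filter fun i : Fin (n + 1) => γ i ≠ 0).card * (2 : ℝ) ^ n := by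
  rw [sum_char_sgnU_eq]
  set w := (univ.filter fun i : Fin (n + 1) => γ i ≠ 0).card with hw
  set κ : ZMod 3 := ((c + 2 * n : ℕ) : ZMod 3)
  have hρ : (Real.sqrt 3 / 2 : ℝ) ^ 2 = 3 / 4 := by rw [div_pow, Real.sq_sqrt (by norm_num : (0 : ℝ) ≤ 3)]; norm_num
  have hτ : ∀ τ : ZMod 3, ‖BTV (phase γ) (fT (bellsN B) n κ τ) n 0 0 false‖ ≤ 3 * (Real.sqrt 3 / 2) ^ w * (2 : ℝ) ^ n := by
    intro τ
    have h1 := normSq_le_btvNorm (phase γ) (fT (bellsN B) n κ τ) n 0 0 false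
    have h2 := btvNorm_le_prod γ (fT (bellsN B) n κ τ) (fT_sq_le (bellsN B) n κ τ) n 0
    simp only [zero_add] at h2
    have h3 := prod_site_le γ
    have h4 := btvNorm_zero_le (phase γ) (fT (bellsN B) n κ τ) (fT_sq_le (bellsN B) n κ τ) n
      (norm_phase_le_one γ _)
    have h5 : 0 ≤ btvNorm (phase γ) (fT (bellsN B) n κ τ) 0 n := by unfold btvNorm cnsq6; positivity
    have h6 : 0 ≤ (∏ g ∈ range n, 4 * siteRho γ (Real.sqrt 3 / 2) g ^ 2) :=
      Finset.prod_nonneg fun g _ => by positivity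
    -- `‖S_τ‖² ≤ (4/3)·4^n·(3/4)^w·6 = 8·(2^n)²·((√3/2)^w)²`
    have hsq : ‖BTV (phase γ) (fT (bellsN B) n κ τ) n 0 0 false‖ ^ 2 ≤
        8 * ((Real.sqrt 3 / 2) ^ w * (2 : ℝ) ^ n) ^ 2 := by
      have e1 : ((Real.sqrt 3 / 2) ^ w * (2 : ℝ) ^ n) ^ 2 = (3 / 4 : ℝ) ^ w * (4 : ℝ) ^ n := by
        rw [mul_pow, ← pow_mul, mul_comm w 2, pow_mul, hρ, ← pow_mul, mul_comm n 2, pow_mul]; norm_num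
      rw [e1]
      have h34 : 0 ≤ (3 / 4 : ℝ) ^ w * (4 : ℝ) ^ n := by positivity
      calc ‖BTV (phase γ) (fT (bellsN B) n κ τ) n 0 0 false‖ ^ 2
          ≤ (∏ g ∈ range n, 4 * siteRho γ (Real.sqrt 3 / 2) g ^ 2) *
              btvNorm (phase γ) (fT (bellsN B) n κ τ) 0 n := h1.trans h2
        _ ≤ (4 / 3 * (4 : ℝ) ^ n * (3 / 4 : ℝ) ^ w) * 6 :=
            mul_le_mul h3 h4 h5 (by positivity)
        _ = 8 * ((3 / 4 : ℝ) ^ w * (4 : ℝ) ^ n) := by ring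
    have hX : 0 ≤ (Real.sqrt 3 / 2) ^ w * (2 : ℝ) ^ n := by positivity
    have h9 : ‖BTV (phase γ) (fT (bellsN B) n κ τ) n 0 0 false‖ ^ 2 ≤ (3 * ((Real.sqrt 3 / 2) ^ w * (2 : ℝ) ^ n)) ^ 2 := by
      nlinarith
    have := abs_le_of_sq_le_sq h9 (by positivity)
    rw [abs_norm] at this
    linarith
  calc ‖∑ τ : ZMod 3, BTV (phase γ) (fT (bellsN B) n κ τ) n 0 0 false‖
      ≤ ∑ τ : ZMod 3, ‖BTV (phase γ) (fT (bellsN B) n κ τ) n 0 0 false‖ := norm_sum_le _ _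
    _ ≤ ∑ _τ : ZMod 3, 3 * (Real.sqrt 3 / 2) ^ w * (2 : ℝ) ^ n := sum_le_sum fun τ _ => hτ τ
    _ = 9 * (Real.sqrt 3 / 2) ^ w * (2 : ℝ) ^ n := by rw [sum_const, card_univ, ZMod.card]; simp; ring

/-! ## The theorem -/

/-- **`twistBoundX3 : TwistBoundX3` — PROVED** (with `A = 9`). -/
theorem twistBoundX3 : TwistBoundX3 := by
  classical
  refine ⟨9, fun N B γ => ?_⟩
  set w := (univ.filter fun i : Fin N => γ i ≠ 0).card with hw
  have hρ1 : (Real.sqrt 3 / 2 : ℝ) ≤ 1 := by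
    rw [div_le_one (by norm_num : (0:ℝ) < 2)]
    have := Real.sqrt_le_sqrt (show (3 : ℝ) ≤ 4 by norm_num)
    rwa [show (4 : ℝ) = 2 ^ 2 by norm_num, Real.sqrt_sq (by norm_num : (0:ℝ) ≤ 2)] at this
  have hρ0 : (0 : ℝ) ≤ Real.sqrt 3 / 2 := by positivity
  -- small `N`: the trivial bound
  by_cases hN : N ≤ 2
  · have hwN : w ≤ N := (card_filter_le _ _).trans (by simp)
    have htriv : ‖∑ x : Fin N → Bool, (ZMod.stdAddChar (∑ i : Fin N, if x i then γ i else 0) : ℂ) *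
        (if (OddZeros x ∧ RingHLF.Rel x (fun k => xor (tGuess x k) (decide (k ∈ B)))) then (1 : ℂ) else 0)‖ ≤
        (2 : ℝ) ^ N := by
      refine (norm_sum_le _ _).trans ?_
      have hterm : ∀ x : Fin N → Bool, ‖(ZMod.stdAddChar (∑ i : Fin N, if x i then γ i else 0) : ℂ) *
          (if (OddZeros x ∧ RingHLF.Rel x (fun k => xor (tGuess x k) (decide (k ∈ B)))) then (1 : ℂ) else 0)‖ ≤ 1 := by
        intro x
        rw [norm_mul]
        have h1 : ‖(ZMod.stdAddChar (∑ i : Fin N, if x i then γ i else 0) : ℂ)‖ ≤ 1 := by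
          have h3 := stdAddChar_cube (∑ i : Fin N, if x i then γ i else 0)
          have hn : ‖(ZMod.stdAddChar (∑ i : Fin N, if x i then γ i else 0) : ℂ)‖ ^ 3 = 1 := by
            rw [← norm_pow, h3, norm_one]
          exact ((pow_eq_one_iff_of_nonneg (norm_nonneg _) (by norm_num)).1 hn).le
        have h2 : ‖(if (OddZeros x ∧ RingHLF.Rel x (fun k => xor (tGuess x k) (decide (k ∈ B)))) then (1 : ℂ) else 0)‖
            ≤ 1 := by split_ifs <;> simp
        exact mul_le_one₀ h1 (norm_nonneg _) h2
      refine (sum_le_sum fun x _ => hterm x).trans ?_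
      rw [sum_const, card_univ, Fintype.card_fun, Fintype.card_bool, Fintype.card_fin]
      simp
    refine htriv.trans ?_
    have hw2 : (Real.sqrt 3 / 2 : ℝ) ^ 2 ≤ (Real.sqrt 3 / 2) ^ w := pow_le_pow_of_le_one hρ0 hρ1 (by omega)
    have hρ : (Real.sqrt 3 / 2 : ℝ) ^ 2 = 3 / 4 := by rw [div_pow, Real.sq_sqrt (by norm_num : (0 : ℝ) ≤ 3)]; norm_num
    have h2N : (0 : ℝ) < (2 : ℝ) ^ N := by positivity
    nlinarith
  -- `N = n + 1`, `n ≥ 2`: transport to walk coordinates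
  obtain ⟨n, rfl⟩ : ∃ n, N = n + 1 := ⟨N - 1, by omega⟩
  have hn : 2 ≤ n := by omega
  set F : (Fin (n + 1) → Bool) → ℂ := fun x => (ZMod.stdAddChar (∑ i : Fin (n + 1), if x i then γ i else 0) : ℂ) *
    (if (OddZeros x ∧ RingHLF.Rel x (fun k => xor (tGuess x k) (decide (k ∈ B)))) then (1 : ℂ) else 0) with hF
  set G : (Fin n → Bool) → ℂ := fun u => (ZMod.stdAddChar (∑ i : Fin (n + 1), if xOfU u i then γ i else 0) : ℂ) *
    (if ringWinU (n + 2) (fun g _ => decide (g ∈ B)) u = true then (1 : ℂ) else 0) with hG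
  -- restrict to the odd class and transport
  have hodd : ∑ x : Fin (n + 1) → Bool, F x =
      ∑ x ∈ (univ.filter fun x : Fin (n + 1) → Bool => (univ.filter fun j : Fin (n + 1) => x j = false).card % 2 = 1),
        G (uVec x) := by
    rw [← Finset.sum_filter_add_sum_filter_not univ
      (fun x : Fin (n + 1) → Bool => (univ.filter fun j : Fin (n + 1) => x j = false).card % 2 = 1) F]
    have hzero : ∑ x ∈ univ.filter (fun x : Fin (n + 1) → Bool =>
        ¬ (univ.filter fun j : Fin (n + 1) => x j = false).card % 2 = 1), F x = 0 := by
      refine Finset.sum_eq_zero fun x hx => ?_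
      rw [mem_filter] at hx
      have : ¬ (OddZeros x ∧ RingHLF.Rel x (fun k => xor (tGuess x k) (decide (k ∈ B)))) := fun h => hx.2 h.1
      simp only [hF, this, if_false, mul_zero]
    rw [hzero, add_zero]
    refine Finset.sum_congr rfl fun x hx => ?_
    rw [mem_filter] at hx
    have hxo : OddZeros x := hx.2
    have hrel := rel_iff_ringWinU hn x hx.2 (fun x k => xor (tGuess x k) (decide (k ∈ B)))
    have hy' : (fun (g : Fin (n + 1)) (u : Fin n → Bool) =>
        xor (xor (tGuess (xOfU u) g) (decide (g ∈ B))) (tGuess (xOfU u) g)) =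
        fun (g : Fin (n + 1)) (_ : Fin n → Bool) => decide (g ∈ B) := by
      funext g u
      generalize tGuess (xOfU u) g = t
      generalize decide (g ∈ B) = d
      cases t <;> cases d <;> rfl
    rw [hy'] at hrel
    simp only [hF, hG, xOfU_uVec hn x hx.2]
    by_cases hr : RingHLF.Rel x (fun k => xor (tGuess x k) (decide (k ∈ B)))
    · rw [if_pos ⟨hxo, hr⟩, if_pos (hrel.1 hr)]
    · rw [if_neg (fun h => hr h.2), if_neg (fun h => hr (hrel.2 h))]
  rw [hodd, sum_odd_eq_sum_u hn G]
  -- `[WIN] = (sgnU_∅ − sgnU_B)/2`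
  have hGsplit : ∀ u : Fin n → Bool, G u =
      ((ZMod.stdAddChar (∑ i : Fin (n + 1), if xOfU u i then γ i else 0) : ℂ) * (sgnU (n + 2) ∅ u : ℂ) -
        (ZMod.stdAddChar (∑ i : Fin (n + 1), if xOfU u i then γ i else 0) : ℂ) * (sgnU (n + 2) B u : ℂ)) / 2 := by
    intro u
    simp only [hG]
    rw [win_indicator_eq, sgnU_empty]
    push_cast
    ring
  simp_rw [hGsplit]
  rw [← Finset.sum_div, Finset.sum_sub_distrib, norm_div, Complex.norm_two]
  have hA := norm_sum_char_sgnU_le γ (n + 2) ∅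
  have hB := norm_sum_char_sgnU_le γ (n + 2) B
  have htri := norm_sub_le
    (∑ u : Fin n → Bool, (ZMod.stdAddChar (∑ i : Fin (n + 1), if xOfU u i then γ i else 0) : ℂ) * (sgnU (n + 2) ∅ u : ℂ))
    (∑ u : Fin n → Bool, (ZMod.stdAddChar (∑ i : Fin (n + 1), if xOfU u i then γ i else 0) : ℂ) * (sgnU (n + 2) B u : ℂ))
  rw [pow_succ]
  have hX : 0 ≤ (Real.sqrt 3 / 2) ^ w * (2 : ℝ) ^ n := by positivity
  linarith

/-! ## Rung R-lin3 modulo its main term -/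

/-- **Rung R-lin3, error term discharged**: `RingLinFormsSharp3` (tables of `≤ (log₂N)^C` linear forms mod 3) now follows
from the main term `RingJuntaBellsSharp3` alone. -/
theorem ringLinFormsSharp3_of_junta (hJ : RingJuntaBellsSharp3) : RingLinFormsSharp3 :=
  ringLinFormsSharp3_of twistBoundX3 hJ

/-- … and hence from the free-window statement `RingWindowBellsSharp3` (R0 ∨ E2 on a window). -/
theorem ringLinFormsSharp3_of_window (hW : RingWindowBellsSharp3) : RingLinFormsSharp3 :=
  ringLinFormsSharp3_of_junta (ringJuntaBellsSharp3_of_window hW)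

/-- The route-facing `θ < 1` form of R-lin3, modulo `RingWindowBellsSharp3`. -/
theorem ringLinFormsLt3_of_window (hW : RingWindowBellsSharp3) : RingLinFormsLt3 :=
  ringLinFormsLt3_of_sharp (ringLinFormsSharp3_of_window hW)

end BondTwist3

end Summit.QuantumAdvantage.AdviceFreeQNC0

end
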